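import Summits.QuantumFields.QCD.Theses.PauliWegnerSea
import Literature.MathematicalPhysics.QuantumFieldTheory.QCDCurrentSector
import Literature.MathematicalPhysics.QuantumFieldTheory.QCDTimeReflection
import Summits.QuantumFields.QCD.Theorems.SpectralDefectExtinctionWindowExtinctionChessboardTransferFragments
import Summits.QuantumFields.QCD.Theorems.PauliWegnerSeaChiralOneScaleTrajectoryStubApTranslation
import Summits.QuantumFields.QCD.Theorems.PauliWegnerSeaChiralOneScaleTrajectoryStubTransferPositivity
import Summits.QuantumFields.QCD.Theorems.PauliWegnerSeaChiralOneScaleTrajectoryStubChord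
import Summits.QuantumFields.QCD.Theorems.PauliWegnerSeaChiralOneScaleTrajectoryStubPinOfLatticeLightness

/-!
# Route-posited objects of line `log-convex-continuum-lift` of crux `PauliWegnerSea.ChiralOneScaleTrajectory`
(stmt-QuantumFields-17512): NAMED forms of the lattice-lightness data and of the light witness, with the landed pin theorem
restated over them (lead a3-0, `--supports`; the `<RouteSlug>Defs`-type file of CONVENTIONS §6 for this line)

The line's stubs were landed DEF-FREE (statements through a local notation prelude).  For the planners' restatement of #5
(PROMOTE.md on the item: "replace the pin conjunct by `LogRoom ∧ TwistInsensitive ∧ LatticeLightness` for the same `reg`", or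
"file the light witness as the promoted item") the same Props are given here as honest definitions, byte-compatible with the
notation prelude (each `def` body IS the notation's expansion, so the bridge to the landed theorems is definitional):

* `numAP`, `numP`, `zAP`, `zP`, `smearedAP` — the un-normalised antiperiodic / periodic flavoured pion numerators and partition
  functions on the torus of side `2S+1`, and the source-and-sink smeared antiperiodic trace;
* `LogRoom reg`, `TwistInsensitive reg`, `LatticeLightness reg`, `Package reg` (the crux's four clauses for every positive mass
  tuple, VERBATIM), `LightWitness Nf`;
* `isChiralAtZero_of_latticeLightness'` — the pin half of the crux as a theorem for every regularisation, over the defs;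
* `chiralOneScaleTrajectory_of_lightWitness'` — `(∀ N_f ∈ {2,3}, LightWitness N_f) → ChiralOneScaleTrajectory`;
* `lightWitness_of_chiralOneScaleTrajectoryR`-free: no converse is claimed (LightWitness is STRONGER than the crux restricted to `N_f`).

Nothing here is a cited fact; all Props are route-posited statement abbreviations (crux-plan card
`Cruxes/ChiralOneScaleTrajectory/Ideas/log-convex-continuum-lift.md`). [folklore]
-/

noncomputable section

namespace Summit.QuantumFields.QCD.Cruxes.ChiralOneScaleTrajectory.LogConvexLift

open scoped BigOperators Topology
open MeasureTheory Filter
open Literature.MathematicalPhysics.QuantumFieldTheory Literature.MathematicalPhysics.QuantumLattice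
  Literature.Probability.LatticeModels

/-! ### Definitions -/

variable {Nf : ℕ}

/-- **Antiperiodic flavoured pion numerator** (UN-normalised) on the torus of side `2S+1`:
`N_AP(v) = ∫dμ_W(β) ∫dψ̄dψ (ψ̄_g γ₅ ψ_f)(0) (ψ̄_f γ₅ ψ_g)(v) e^{−ψ̄ D_AP(U) ψ}` — the transfer-matrix trace
(Montvay–Münster (4.34)); `v : Site 4` is read modulo `2S+1`. (The line's local notation `nAP⟪β, S, mq, f, g, v⟫` expands to this body.) -/
def numAP (β : ℝ) (S : ℕ) (mq : Fin Nf → ℝ) (f g : Fin Nf) (v : Literature.Probability.LatticeModels.Site 4) : ℂ :=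
  ∫ U : GaugeConfig 4 (2 * S + 1) (Matrix.specialUnitaryGroup (Fin 3) ℂ),
      fermiIntegral (torusBilinear g f (Torus.proj (2 * S + 1) 0) (Torus.proj (2 * S + 1) 0) gammaFive 1 *
          torusBilinear f g (Torus.proj (2 * S + 1) v) (Torus.proj (2 * S + 1) v) gammaFive 1 *
        fermiBoltzmannAP U mq)
    ∂(wilsonMeasure (fundamentalRep (Fin 3)) β)

/-- **Periodic flavoured pion numerator** (UN-normalised; the Statement's time-periodic `fermiBoltzmann`, i.e. the
`(−1)^F`-twisted trace): the numerator of the honest correlator entering `HasLatticeMassGap`. Notation `nP⟪…⟫`. -/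
def numP (β : ℝ) (S : ℕ) (mq : Fin Nf → ℝ) (f g : Fin Nf) (v : Literature.Probability.LatticeModels.Site 4) : ℂ :=
  ∫ U : GaugeConfig 4 (2 * S + 1) (Matrix.specialUnitaryGroup (Fin 3) ℂ),
      fermiIntegral (torusBilinear g f (Torus.proj (2 * S + 1) 0) (Torus.proj (2 * S + 1) 0) gammaFive 1 *
          torusBilinear f g (Torus.proj (2 * S + 1) v) (Torus.proj (2 * S + 1) v) gammaFive 1 *
        fermiBoltzmann U mq)
    ∂(wilsonMeasure (fundamentalRep (Fin 3)) β)

/-- Antiperiodic partition function `Z_AP = ∫dμ_W ∫dψ̄dψ e^{−ψ̄ D_AP ψ}` (notation `zAP⟪β, S, mq⟫`). -/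
def zAP (β : ℝ) (S : ℕ) (mq : Fin Nf → ℝ) : ℂ :=
  ∫ U : GaugeConfig 4 (2 * S + 1) (Matrix.specialUnitaryGroup (Fin 3) ℂ),
      fermiIntegral (fermiBoltzmannAP U mq) ∂(wilsonMeasure (fundamentalRep (Fin 3)) β)

/-- Periodic partition function `Z_P = ∫dμ_W ∫dψ̄dψ e^{−ψ̄ D ψ}` (notation `zP⟪β, S, mq⟫`). -/
def zP (β : ℝ) (S : ℕ) (mq : Fin Nf → ℝ) : ℂ :=
  ∫ U : GaugeConfig 4 (2 * S + 1) (Matrix.specialUnitaryGroup (Fin 3) ℂ),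
      fermiIntegral (fermiBoltzmann U mq) ∂(wilsonMeasure (fundamentalRep (Fin 3)) β)

/-- **Source-and-sink smeared antiperiodic trace** `𝒟_h(n) = Σ_{z,z' ∈ T} h(z) h(z') N_AP(n e₀ + z' − z)` for a real
profile `h` on a finite set `T` of sites (notation `dAP⟪β, S, mq, f, g, T, h, n⟫`). -/
def smearedAP (β : ℝ) (S : ℕ) (mq : Fin Nf → ℝ) (f g : Fin Nf)
    (T : Finset (Literature.Probability.LatticeModels.Site 4)) (h : Literature.Probability.LatticeModels.Site 4 → ℝ)
    (n : ℕ) : ℂ :=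
  ∑ z ∈ T, ∑ z' ∈ T, ((h z * h z' : ℝ) : ℂ) * numAP β S mq f g (Pi.single (0 : Fin 4) ((n : ℕ) : ℤ) + (z' - z))

/-- **LogRoom**: superlogarithmic physical volume, `a_k L_k / (1 + |log a_k|) → ∞` (necessary for the package anyway,
`Negative/VolumeGrowth`; it puts the log shell inside the scheme's own torus). Notation `LOGROOM⟪reg⟫`. -/
def LogRoom (reg : QCDRegularisation Nf) : Prop :=
  Tendsto (fun k => reg.a k * (reg.L k : ℝ) / (1 + |Real.log (reg.a k)|)) atTop atTop

/-- **TwistInsensitive**: at `S = L_k`, for every positive mass tuple, flavour pair and `K`, eventually in `k`, the periodic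
and antiperiodic partition functions agree within a factor `3/2` and so do the pion numerators on the time axis at separations
`n a_k ≤ K(1+|log a_k|)` (the `(−1)^F` twist = odd-baryon-number sector is invisible at log-scale separations).
Notation `TWIST⟪Nf, reg⟫`. -/
def TwistInsensitive (reg : QCDRegularisation Nf) : Prop :=
  ∀ (m : Fin Nf → ℝ), (∀ fl, 0 < m fl) → ∀ (f g : Fin Nf), f ≠ g → ∀ K : ℝ, ∀ᶠ k in atTop,
    2 * ‖zAP (reg.β k) (reg.L k) (fun fl => reg.mcrit k + reg.a k * m fl / reg.Zm k) -
          zP (reg.β k) (reg.L k) (fun fl => reg.mcrit k + reg.a k * m fl / reg.Zm k)‖ ≤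
      ‖zAP (reg.β k) (reg.L k) (fun fl => reg.mcrit k + reg.a k * m fl / reg.Zm k)‖ ∧
    ∀ n : ℕ, (n : ℝ) * reg.a k ≤ K * (1 + |Real.log (reg.a k)|) →
      2 * ‖numAP (reg.β k) (reg.L k) (fun fl => reg.mcrit k + reg.a k * m fl / reg.Zm k) f g
              (Pi.single (0 : Fin 4) ((n : ℕ) : ℤ)) -
            numP (reg.β k) (reg.L k) (fun fl => reg.mcrit k + reg.a k * m fl / reg.Zm k) f g
              (Pi.single (0 : Fin 4) ((n : ℕ) : ℤ))‖ ≤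
        ‖numAP (reg.β k) (reg.L k) (fun fl => reg.mcrit k + reg.a k * m fl / reg.Zm k) f g
            (Pi.single (0 : Fin 4) ((n : ℕ) : ℤ))‖

/-- **LatticeLightness** (even lattice times): for every rate `ε > 0` some positive mass tuple, flavour pair `f ≠ g`, physical
distance bound `R`, floor exponent `p` and constant `C > 0` have, FREQUENTLY in `k`, a real profile `h` on a finite set `T` of
time-zero sites of sup-radius `≤ n₂` and lattice times `1 ≤ n₁ < n₂`, `n₂ a_k ≤ R`, with `0 < Σ|h|`, `0 < ‖Z_AP‖`, the floor
`C a_k^p (Σ|h|)² ‖Z_AP‖ ≤ ‖𝒟_h(2n₂)‖` and the lightness bound `‖𝒟_h(2n₁)‖ ≤ ‖𝒟_h(2n₂)‖ e^{ε a_k (n₂ − n₁)}` (average log-slope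
between the two physical distances at most `ε/2` in physical units), all at `S = L_k`. Notation `LIGHT⟪Nf, reg⟫`. -/
def LatticeLightness (reg : QCDRegularisation Nf) : Prop :=
  ∀ ε : ℝ, 0 < ε → ∃ m : Fin Nf → ℝ, (∀ fl, 0 < m fl) ∧ ∃ (f g : Fin Nf), f ≠ g ∧
    ∃ (R : ℝ) (p : ℕ) (C : ℝ), 0 < C ∧ ∃ᶠ k in atTop,
      ∃ (T : Finset (Literature.Probability.LatticeModels.Site 4)) (h : Literature.Probability.LatticeModels.Site 4 → ℝ)
        (n₁ n₂ : ℕ),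
        1 ≤ n₁ ∧ n₁ < n₂ ∧ (n₂ : ℝ) * reg.a k ≤ R ∧
        (∀ z ∈ T, z 0 = 0 ∧ ∀ i, |z i| ≤ (n₂ : ℤ)) ∧
        0 < ∑ z ∈ T, |h z| ∧
        0 < ‖zAP (reg.β k) (reg.L k) (fun fl => reg.mcrit k + reg.a k * m fl / reg.Zm k)‖ ∧
        C * reg.a k ^ p * ((∑ z ∈ T, |h z|) ^ 2 *
            ‖zAP (reg.β k) (reg.L k) (fun fl => reg.mcrit k + reg.a k * m fl / reg.Zm k)‖) ≤
          ‖smearedAP (reg.β k) (reg.L k) (fun fl => reg.mcrit k + reg.a k * m fl / reg.Zm k) f g T h (2 * n₂)‖ ∧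
        ‖smearedAP (reg.β k) (reg.L k) (fun fl => reg.mcrit k + reg.a k * m fl / reg.Zm k) f g T h (2 * n₁)‖ ≤
          ‖smearedAP (reg.β k) (reg.L k) (fun fl => reg.mcrit k + reg.a k * m fl / reg.Zm k) f g T h (2 * n₂)‖ *
            Real.exp (ε * (reg.a k * ((n₂ : ℝ) - n₁)))

/-- **The crux's package at `reg`**: for every positive renormalised mass tuple, clauses (i), (one-scale), (iii) LOWER and
(iv) SIGN of `PauliWegnerSea.ChiralOneScaleTrajectory`, VERBATIM (= stmt-QuantumFields-11513 `OneScaleTrajectory`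
restricted to this `reg`, without the scalings). -/
def Package (reg : QCDRegularisation Nf) : Prop :=
  (∀ m : Fin Nf → ℝ, (∀ f, 0 < m f) → (∀ f : Fin Nf, ∀ᶠ k in atTop, -1 < reg.mcrit k + reg.a k * m f / reg.Zm k) ∧ (∀ q : ℕ, ∃ K₀ s : ℝ, 0 < s ∧ s < 1 ∧ ∀ᶠ k in atTop, ∃ ℓ₀ : ℕ, 1 ≤ ℓ₀ ∧ ℓ₀ ≤ reg.L k ∧ (ℓ₀ : ℝ) * reg.a k ≤ K₀ * (1 + |Real.log (reg.a k)|) ∧ ∀ S : ℕ, reg.L k ≤ S → ∀ (f : Fin Nf) (v : Literature.Probability.LatticeModels.Site 4), v ∈ box 4 S → ‖v‖ = (ℓ₀ : ℝ) → (ℓ₀ : ℝ) ^ q * (1 + |reg.β k|) ^ q * ((∫ U : GaugeConfig 4 (2 * S + 1) (Matrix.specialUnitaryGroup (Fin 3) ℂ), ‖(diracMatrix U fun fl => reg.mcrit k + reg.a k * m fl / reg.Zm k).det‖ * (∑ a : Fin 3, ∑ i : Fin 4, ∑ b : Fin 3, ∑ j : Fin 4, ‖(diracMatrix U fun fl =>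 reg.mcrit k + reg.a k * m fl / reg.Zm k)⁻¹ (quarkEquiv (f, (Torus.proj (2 * S + 1) 0, a, i))) (quarkEquiv (f, (Torus.proj (2 * S + 1) (v), b, j)))‖) ^ s ∂(wilsonMeasure (fundamentalRep (Fin 3)) (reg.β k))) / (∫ U : GaugeConfig 4 (2 * S + 1) (Matrix.specialUnitaryGroup (Fin 3) ℂ), ‖(diracMatrix U fun fl => reg.mcrit k + reg.a k * m fl / reg.Zm k).det‖ ∂(wilsonMeasure (fundamentalRep (Fin 3)) (reg.β k)))) ≤ 1) ∧ (∃ s c₀ C₁ p : ℝ, 0 < s ∧ s < 1 ∧ 0 < c₀ ∧ ∀ᶠ k in atTop, ∀ S : ℕ, reg.L k ≤ S → ∀ (f : Fin Nf) (n : ℕ), n ≤ S → c₀ * Real.exp (-(C₁ * (reg.a k * n) + p * Real.log (n + 1))) ≤ (∫ U : GaugeConfig 4 (2 * S + 1) (Matrix.specialUnitaryGroup (Fin 3) ℂ), ‖(diracMatrix U fun fl => reg.mcrit k + reg.a k * m fl / reg.Zm k).det‖ * (∑ a : Fin 3, ∑ i : Fin 4, ∑ b : Fin 3, ∑ j : Fin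 4, ‖(diracMatrix U fun fl => reg.mcrit k + reg.a k * m fl / reg.Zm k)⁻¹ (quarkEquiv (f, (Torus.proj (2 * S + 1) 0, a, i))) (quarkEquiv (f, (Torus.proj (2 * S + 1) (Pi.single 0 (n : ℤ)), b, j)))‖) ^ s ∂(wilsonMeasure (fundamentalRep (Fin 3)) (reg.β k))) / (∫ U : GaugeConfig 4 (2 * S + 1) (Matrix.specialUnitaryGroup (Fin 3) ℂ), ‖(diracMatrix U fun fl => reg.mcrit k + reg.a k * m fl / reg.Zm k).det‖ ∂(wilsonMeasure (fundamentalRep (Fin 3)) (reg.β k)))) ∧ (∀ᶠ k in atTop, (1 / 2 : ℝ) ≤ ‖∫ U : GaugeConfig 4 (2 * reg.L k + 1) (Matrix.specialUnitaryGroup (Fin 3) ℂ), (diracMatrix U fun fl => reg.mcrit k + reg.a k * m fl / reg.Zm k).det ∂(wilsonMeasure (fundamentalRep (Fin 3)) (reg.β k))‖ / (∫ U : GaugeConfig 4 (2 * reg.L k + 1) (Matrix.specialUnitaryGroup (Fin 3) ℂ), ‖(diracMatrix U fun fl => reg.mcrit k + reg.a k * m fl / reg.Zm k).det‖ ∂(wilsonMeasure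 (fundamentalRep (Fin 3)) (reg.β k)))))

variable (Nf) in
/-- **The light witness `C⁺`** of the line (= registered open stub `stub_lightWitness` at `Nf`): ONE mass-independent
regularisation with leading-log mass scaling and two-loop asymptotic scaling carrying the package for every positive mass
tuple, together with `LogRoom`, `TwistInsensitive` and `LatticeLightness`. STRONGER than the crux restricted to `Nf`. -/
def LightWitness : Prop :=
  ∃ reg : QCDRegularisation Nf, reg.HasMassScaling ∧ (reg.scheme 0 0 0).HasAsymptoticScaling ∧ Package reg ∧
    LogRoom reg ∧ TwistInsensitive reg ∧ LatticeLightness reg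

/-! ### The landed pin theorem and the reduction, over the definitions -/

/-- **The chirality pin from lattice lightness, every regularisation** (named form of the landed composition
`Lift.stub_pinOfLatticeLightness ∘ TransferPositivity.stub_transferPositivity ∘ APTranslation.stub_apTranslation`,
`Chord.stub_chord`): `β_k ≥ 0` eventually, clause (i), `LogRoom`, `TwistInsensitive`, `LatticeLightness` ⇒ `IsChiralAtZero`. -/
theorem isChiralAtZero_of_latticeLightness' : ∀ (reg : QCDRegularisation Nf), (∀ᶠ k in atTop, 0 ≤ reg.β k) →
    (∀ m : Fin Nf → ℝ, (∀ f, 0 < m f) → ∀ f : Fin Nf, ∀ᶠ k in atTop, -1 < reg.mcrit k + reg.a k * m f / reg.Zm k) →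
    LogRoom reg → TwistInsensitive reg → LatticeLightness reg → reg.IsChiralAtZero :=
  fun reg hβ hI hroom htwist hlight =>
    Lift.stub_pinOfLatticeLightness Nf
      (TransferPositivity.stub_transferPositivity Nf (APTranslation.stub_apTranslation Nf)) Chord.stub_chord
      reg hβ hI hroom htwist hlight

/-- **The crux BY NAME from the light witness** (named form): `(∀ N_f ∈ {2,3}, LightWitness N_f) → ChiralOneScaleTrajectory`. -/
theorem chiralOneScaleTrajectory_of_lightWitness' : (∀ Nf : ℕ, Nf = 2 ∨ Nf = 3 → LightWitness Nf) →
    Summit.QuantumFields.QCD.Theses.PauliWegnerSea.ChiralOneScaleTrajectory := by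
  intro hLW Nf hNf
  have h16 : Nf ≤ 16 := by rcases hNf with rfl | rfl <;> norm_num
  obtain ⟨reg, hMS, hAS, hpkg, hroom, htwist, hlight⟩ := hLW Nf hNf
  have hβ : ∀ᶠ k in atTop, 0 ≤ reg.β k :=
    (Summit.QuantumFields.QCD.Cruxes.WindowExtinction.ChessboardColdCells.tendsto_beta_atTop_of_hasAsymptoticScaling
      h16 reg hAS).eventually_ge_atTop 0
  exact ⟨reg, hMS, isChiralAtZero_of_latticeLightness' reg hβ (fun m hm => (hpkg m hm).1) hroom htwist hlight, hAS, hpkg⟩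

end Summit.QuantumFields.QCD.Cruxes.ChiralOneScaleTrajectory.LogConvexLift

end
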